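import Literature.NumberTheory.EllipticCurves.TowerLimitPairingPerfectProofs
import Literature.GroupTheory.FiniteAbelian.HomCounts
import HarnessLib

/-!
# Representability of functionals on the SATURATED families of a tower by the dual tower — the rank-free (e) of
# Howard's H.4 (Exact) for `F_𝔮` at `v ∣ p` (generic tower algebra; proofs file)

Topic `NumberTheory/EllipticCurves`; THEOREMS ONLY (no definition, no named fact, no instance, no notation, no `sorry`),
in the currency of the tree's abstract towers `Literature.NumberTheory.EllipticCurves.Tower.*` (`compatibleFamilies`,
`saturatedFamilies red p C`, `levelCondition red p C k` of `ZpExtensionEisensteinSelmerStructure`; Kőnig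
`exists_mem_compatibleFamilies_of_forall_mem` of `TowerSaturatedCartesianPresentedProofs`), sequel of x10b-p1-w8's
`TowerLimitPairingPerfectProofs` §4 (`exists_mem_compatibleFamilies_forall_pairing_eq[_fun]`: functionals on ALL compatible
families, represented on the LIFTABLE classes) — here the functionals live on the SATURATED families / saturated level
conditions, as the rank-free proof of (Exact) needs (cell `pub/bsd-print-x9`, LEAD memo
`HOME/p1/H4-EXACT-AT-P-PLAN-x10b-p1-g8.md` §1(e), brick (B5); shared μ-crux `MuInequalityCoherentPairOfHoward`,
stmt-BirchSwinnertonDyer-23088, STUB A field `SatisfiesH.h4` at `v ∣ p`).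

* §1 (finite abelian groups, `Literature.GroupTheory.FiniteAbelian.…`) `natCard_addMonoidHom_zmod_eq_card` (`#Hom(G, ℤ/n) = #G`
  for finite `n`-torsion `G`, from the tree's `natCard_addMonoidHom_zmod_right`), **`exists_addMonoidHom_extend_zmod`** —
  characters `L → ℤ/n` EXTEND from subgroups of a finite `n`-torsion group (counting: the restriction has kernel inside
  `Hom(G/L, ℤ/n)`), `pairing_reading_surjective_of_injective` — if both adjoints of a reading `λ ∘ B : X × Y → ℤ/n` are
  injective then `y ↦ λ ∘ B(·, y)` is ONTO `Hom(X, ℤ/n)` (counting).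
* §2 (one level) `exists_forall_reading_pairing_eq_of_subgroup` (a character of a SUBGROUP `L ≤ X_k` is `λ ∘ B_k(·, y)|_L`),
  **`exists_forall_mem_pairing_eq_of_frobenius`** — a function `g : X_k → Q_k` additive and `A`-homogeneous on an
  `A`-stable subgroup `L` is `B_k(·, y)` on `L`, given the onto reading adjoint, `B_k` `A`-linear in `x`, and the FROBENIUS
  property of `λ` (`(∀ r, λ (r • q) = λ (r • q′)) → q = q′`; for `A_{m,k}` and the tail form: the tree's
  `bijective_comp_tailFormZMod_dualFamily_mul`).
* §3 (towers) **`exists_mem_compatibleFamilies_forall_saturated_pairing_eq`** — level functions `g_k` compatible along the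
  saturated families (`redQ (g_{k+1} ξ_{k+1}) = g_k ξ_k`) and represented on `levelCondition red p C k` at each (finite) level are
  represented by ONE compatible family `y` of `Y`: `B_k (ξ_k, y_k) = g_k ξ_k` for all saturated `ξ`, all `k` (Kőnig);
  `…_forall_levelCondition_pairing_eq` (conclusion on the level conditions).
* §4 `exists_mem_compatibleFamilies_forall_saturated_pairing_eq_of_readings` (§2 + §3: levelwise perfect readings and
  Frobenius forms ⇒ every compatible, additive, homogeneous family of level functions on the saturated conditions is
  represented) and the FUNCTIONAL FORM **`…_functional`**: one function `Ψ` on families which on the saturated families is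
  well defined levelwise (`Ψ ξ k` depends only on `ξ_k` — in the application from `ker eval_k ∩ Sat = p^k Sat`), additive,
  levelwise homogeneous and compatible-valued, is `ξ ↦ (B_k(ξ_k, y_k))_k` for one compatible `y` — «every balanced additive
  functional `Sat_X → lim Q_j` is represented by `lim Y_j`», the hypothesis `hrep` of
  `Literature.Algebra.Module.exists_sub_smul_mem_of_forall_mem_span` (p649486 §1) in tower currency, WITHOUT ranks,
  `Module.Finite` or an Euler–Poincaré count.
Nothing arithmetic is proved here; no summit statement is proved; BSD is not proved by any of this.

References: J. S. Milne, *Arithmetic Duality Theorems* (2006), I §0 Prop. 0.19, I Cor. 2.3 / Thm. 2.6 (local duality of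
finitely generated modules by passage to the limit over finite levels); B. Howard, Compositio Math. 140 (2004), H.4
(arXiv:1202.6340 p. 7 L78–82) and Def. 3.2.6; T. W. Hungerford, *Algebra* (1974), Ch. IV Thm. 4.7 and §4 Exercise 1 (counting
homomorphisms of finite abelian groups); B. de Smit, K. Rubin, R. Schoof, Cor. 2.2 (dual bases of monogenic algebras);
J.-P. Serre, *Galois Cohomology* (1997), I §2.2; Neukirch–Schmidt–Wingberg (2008), Cor. 2.7.6 (Mittag-Leffler).
-/

set_option autoImplicit false

noncomputable section

universe u v w

/-! ## §1 Characters into `ℤ/n` extend from subgroups of finite `n`-torsion groups -/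

namespace Literature.GroupTheory.FiniteAbelian

/-- `Hom(G, ℤ/n)` is finite for finite `G`. [cite: Hungerford1974, Ch. IV §4 Exercise 1] -/
theorem finite_addMonoidHom_zmod (G : Type*) [AddCommGroup G] [Finite G] (n : ℕ) [NeZero n] :
    Finite (G →+ ZMod n) :=
  Finite.of_injective (fun f : G →+ ZMod n ↦ (f : G → ZMod n)) DFunLike.coe_injective

/-- **`#Hom(G, ℤ/n) = #G` for a finite `n`-torsion group** (`G[n] = G`).
[cite: Hungerford1974, Ch. IV §4 Exercise 1 (a), with Thm. 4.7] -/
theorem natCard_addMonoidHom_zmod_eq_card (G : Type*) [AddCommGroup G] [Finite G] (n : ℕ) [NeZero n]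
    (hG : ∀ g : G, n • g = 0) : Nat.card (G →+ ZMod n) = Nat.card G := by
  rw [natCard_addMonoidHom_zmod_right]
  have htop : AddSubgroup.torsionBy G n = ⊤ := by
    ext g
    simp only [AddSubgroup.torsionBy.nsmul_iff, hG g, AddSubgroup.mem_top]
  rw [htop, AddSubgroup.card_top]

/-- **Characters into `ℤ/n` extend from subgroups** of a finite `n`-torsion abelian group: the restriction
`Hom(G, ℤ/n) → Hom(L, ℤ/n)` is onto (its kernel embeds in `Hom(G/L, ℤ/n)`, and `#Hom(·, ℤ/n) = #(·)` on all three
groups) — injectivity of `ℤ/n` as a `ℤ/n`-module, by counting. [cite: Hungerford1974, Ch. IV §4 Exercise 1 and Thm. 4.7 (counting homomorphisms of finite abelian groups)]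
[cite: MilneADT2006, Ch. I §0 (duality of finite groups)] -/
theorem exists_addMonoidHom_extend_zmod {G : Type*} [AddCommGroup G] [Finite G] {n : ℕ} [NeZero n]
    (hG : ∀ g : G, n • g = 0) (L : AddSubgroup G) (χ : L →+ ZMod n) :
    ∃ Χ : G →+ ZMod n, ∀ x : L, Χ x = χ x := by
  classical
  haveI := finite_addMonoidHom_zmod G n
  haveI := finite_addMonoidHom_zmod L n
  haveI := finite_addMonoidHom_zmod (G ⧸ L) n
  -- the restriction map
  let ρ : (G →+ ZMod n) →+ (L →+ ZMod n) :=
    { toFun := fun Χ ↦ Χ.comp L.subtype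
      map_zero' := rfl
      map_add' := fun _ _ ↦ rfl }
  -- its kernel embeds in `Hom(G/L, ℤ/n)`
  have hker : Nat.card ρ.ker ≤ Nat.card (G ⧸ L →+ ZMod n) := by
    refine Nat.card_le_card_of_injective
      (fun Χ : ρ.ker ↦ QuotientAddGroup.lift L (Χ : G →+ ZMod n) fun x hx ↦ ?_) fun Χ Χ' h ↦ ?_
    · have h0 := Χ.2
      rw [AddMonoidHom.mem_ker] at h0
      exact DFunLike.congr_fun h0 ⟨x, hx⟩
    · apply Subtype.ext
      ext g
      have := DFunLike.congr_fun h (QuotientAddGroup.mk g)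
      simpa only [QuotientAddGroup.lift_mk] using this
  -- counting
  have hGn : Nat.card (G →+ ZMod n) = Nat.card G := natCard_addMonoidHom_zmod_eq_card G n hG
  have hLn : Nat.card (L →+ ZMod n) = Nat.card L :=
    natCard_addMonoidHom_zmod_eq_card L n fun g ↦ Subtype.ext (by
      rw [AddSubgroupClass.coe_nsmul, ZeroMemClass.coe_zero]; exact hG g)
  have hQn : Nat.card (G ⧸ L →+ ZMod n) = Nat.card (G ⧸ L) :=
    natCard_addMonoidHom_zmod_eq_card (G ⧸ L) n fun g ↦ by
      induction g using QuotientAddGroup.induction_on with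
      | H g => rw [← QuotientAddGroup.mk_nsmul, hG, QuotientAddGroup.mk_zero]
  have hdec : Nat.card (G →+ ZMod n) = Nat.card ρ.ker * Nat.card ρ.range := by
    rw [AddSubgroup.card_eq_card_quotient_mul_card_addSubgroup ρ.ker, mul_comm,
      Nat.card_congr (QuotientAddGroup.quotientKerEquivRange ρ).toEquiv]
  have hGL : Nat.card G = Nat.card (G ⧸ L) * Nat.card L := AddSubgroup.card_eq_card_quotient_mul_card_addSubgroup L
  have hrange : Nat.card (L →+ ZMod n) ≤ Nat.card ρ.range := by
    have hpos : 0 < Nat.card (G ⧸ L) := Nat.card_pos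
    rw [hLn]
    apply Nat.le_of_mul_le_mul_left _ hpos
    calc Nat.card (G ⧸ L) * Nat.card L = Nat.card ρ.ker * Nat.card ρ.range := by rw [← hGL, ← hGn, hdec]
      _ ≤ Nat.card (G ⧸ L) * Nat.card ρ.range := Nat.mul_le_mul_right _ (hker.trans hQn.le)
  have htop : ρ.range = ⊤ :=
    AddSubgroup.eq_top_of_card_eq _ (le_antisymm (AddSubgroup.card_le_card_addGroup _) hrange)
  have hχ : χ ∈ ρ.range := htop ▸ AddSubgroup.mem_top χ
  obtain ⟨Χ, hΧ⟩ := hχ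
  exact ⟨Χ, fun x ↦ DFunLike.congr_fun hΧ x⟩


/-- **A perfect reading by counting**: for finite `n`-torsion groups `X`, `Y`, a bi-additive `B : X × Y → Q` and a
reading `λ : Q → ℤ/n`, if BOTH adjoints of `λ ∘ B` are injective then the adjoint `y ↦ λ ∘ B(·, y)` is ONTO
`Hom(X, ℤ/n)` (`#Y ≤ #Hom(X, ℤ/n) = #X ≤ #Hom(Y, ℤ/n) = #Y`). [cite: MilneADT2006, Ch. I §0 (duality of finite groups)]
[cite: Hungerford1974, Ch. IV §4 Exercise 1] -/
theorem pairing_reading_surjective_of_injective {X Y Q : Type*} [AddCommGroup X] [AddCommGroup Y] [AddCommGroup Q]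
    [Finite X] [Finite Y] {n : ℕ} [NeZero n] (hX : ∀ x : X, n • x = 0) (hY : ∀ y : Y, n • y = 0)
    (B : X →+ Y →+ Q) (lam : Q →+ ZMod n)
    (hinjY : ∀ y : Y, (∀ x : X, lam (B x y) = 0) → y = 0)
    (hinjX : ∀ x : X, (∀ y : Y, lam (B x y) = 0) → x = 0) :
    ∀ χ : X →+ ZMod n, ∃ y : Y, ∀ x : X, lam (B x y) = χ x := by
  classical
  haveI := finite_addMonoidHom_zmod X n
  haveI := finite_addMonoidHom_zmod Y n
  -- the two adjoints
  let adY : Y →+ (X →+ ZMod n) :=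
    { toFun := fun y ↦ lam.comp ((B.flip) y)
      map_zero' := by ext x; simp
      map_add' := fun y y' ↦ by ext x; simp }
  let adX : X →+ (Y →+ ZMod n) :=
    { toFun := fun x ↦ lam.comp (B x)
      map_zero' := by ext y; simp
      map_add' := fun x x' ↦ by ext y; simp }
  have hY' : Function.Injective adY := by
    rw [injective_iff_map_eq_zero]
    intro y hy
    exact hinjY y fun x ↦ DFunLike.congr_fun hy x
  have hX' : Function.Injective adX := by
    rw [injective_iff_map_eq_zero]
    intro x hx
    exact hinjX x fun y ↦ DFunLike.congr_fun hx y
  have h1 : Nat.card Y ≤ Nat.card (X →+ ZMod n) := Nat.card_le_card_of_injective _ hY'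
  have h2 : Nat.card X ≤ Nat.card (Y →+ ZMod n) := Nat.card_le_card_of_injective _ hX'
  rw [natCard_addMonoidHom_zmod_eq_card Y n hY] at h2
  have hcard : Nat.card Y = Nat.card (X →+ ZMod n) :=
    le_antisymm h1 ((natCard_addMonoidHom_zmod_eq_card X n hX).trans_le h2)
  have hbij : Function.Bijective adY :=
    (Nat.bijective_iff_injective_and_card _).2 ⟨hY', hcard⟩
  intro χ
  obtain ⟨y, hy⟩ := hbij.2 χ
  exact ⟨y, fun x ↦ DFunLike.congr_fun hy x⟩

end Literature.GroupTheory.FiniteAbelian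

/-! ## §2 Finite level: representability on a subgroup from a perfect reading -/

namespace Literature.NumberTheory.EllipticCurves

namespace Tower

open Literature.GroupTheory.FiniteAbelian

section Level

variable {Xk : Type u} {Yk : Type v} {Qk : Type w} [AddCommGroup Xk] [AddCommGroup Yk] [AddCommGroup Qk]
  [Finite Xk] (Bk : Xk →+ Yk →+ Qk) {n : ℕ} [NeZero n] (lam : Qk →+ ZMod n)

/-- **A character on a SUBGROUP is read off the pairing**: if `X_k` is finite `n`-torsion and the adjoint of the
`λ`-reading `y ↦ λ ∘ B_k(·, y)` is onto `Hom(X_k, ℤ/n)` (finite-level perfectness in the reading), then every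
character `χ : L → ℤ/n` of a subgroup `L ≤ X_k` is `λ ∘ B_k(·, y)|_L` for some `y ∈ Y_k` (extend `χ` by §1).
[cite: MilneADT2006, Ch. I §0 Prop. 0.19 and Cor. 2.3 (finite-level local duality)] -/
theorem exists_forall_reading_pairing_eq_of_subgroup (hX : ∀ x : Xk, n • x = 0)
    (hsurj : ∀ χ : Xk →+ ZMod n, ∃ y : Yk, ∀ x : Xk, lam (Bk x y) = χ x)
    (L : AddSubgroup Xk) (χ : L →+ ZMod n) : ∃ y : Yk, ∀ x : L, lam (Bk x y) = χ x := by
  obtain ⟨Χ, hΧ⟩ := exists_addMonoidHom_extend_zmod hX L χ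
  obtain ⟨y, hy⟩ := hsurj Χ
  exact ⟨y, fun x ↦ (hy x).trans (hΧ x)⟩

/-- **Finite-level representability on a subgroup, upgraded from the reading to the values** by the Frobenius
property of `λ` (`(∀ r, λ (r • q) = λ (r • q′)) → q = q′`: e.g. `λ =` the tail form of `A_{m,k}` onto `ℤ/p^k`,
`bijective_comp_tailFormZMod_dualFamily_mul`): for a function `g : X_k → Q_k` ADDITIVE and `A`-HOMOGENEOUS on an
`A`-stable subgroup `L` and `B_k` `A`-linear in the first variable, some `y ∈ Y_k` has `B_k(x, y) = g x` for
every `x ∈ L`. [cite: MilneADT2006, Ch. I §0 Prop. 0.19] [cite: DeSmitRubinSchoof1997, Cor. 2.2 (dual basis of a monogenic algebra)] -/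
theorem exists_forall_mem_pairing_eq_of_frobenius {A : Type*} [SMul A Xk] [SMul A Qk]
    (hX : ∀ x : Xk, n • x = 0)
    (hsurj : ∀ χ : Xk →+ ZMod n, ∃ y : Yk, ∀ x : Xk, lam (Bk x y) = χ x)
    (hfrob : ∀ q q' : Qk, (∀ r : A, lam (r • q) = lam (r • q')) → q = q')
    (hBlin : ∀ (r : A) (x : Xk) (y : Yk), Bk (r • x) y = r • Bk x y)
    (L : AddSubgroup Xk) (hL : ∀ (r : A) (x : Xk), x ∈ L → r • x ∈ L)
    (g : Xk → Qk) (hgadd : ∀ x ∈ L, ∀ x' ∈ L, g (x + x') = g x + g x')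
    (hgsmul : ∀ (r : A) (x : Xk), x ∈ L → g (r • x) = r • g x) :
    ∃ y : Yk, ∀ x ∈ L, Bk x y = g x := by
  have hg0 : g 0 = 0 := by
    have h := hgadd 0 L.zero_mem 0 L.zero_mem
    rw [add_zero] at h
    exact left_eq_add.1 h
  let χ : L →+ ZMod n :=
    { toFun := fun x ↦ lam (g x)
      map_zero' := by rw [ZeroMemClass.coe_zero, hg0, map_zero]
      map_add' := fun x x' ↦ by rw [AddSubgroup.coe_add, hgadd _ x.2 _ x'.2, map_add] }
  obtain ⟨y, hy⟩ := exists_forall_reading_pairing_eq_of_subgroup Bk lam hX hsurj L χ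
  refine ⟨y, fun x hx ↦ hfrob _ _ fun r ↦ ?_⟩
  rw [← hBlin, ← hgsmul r x hx]
  exact hy ⟨r • x, hL r x hx⟩

end Level

/-! ## §3 Kőnig: compatible level functionals on the SATURATED families are represented by one compatible family -/

section Saturated

variable {X : ℕ → Type u} [∀ j, AddCommGroup (X j)] (red : ∀ j, X (j + 1) →+ X j)
  {Y : ℕ → Type v} [∀ j, AddCommGroup (Y j)] (red' : ∀ j, Y (j + 1) →+ Y j)
  {Q : ℕ → Type w} [∀ j, AddCommGroup (Q j)] (B : ∀ j, X j →+ Y j →+ Q j)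

/-- **Compatible level functionals on the saturated families are represented by ONE compatible family**
(the saturated twin of `exists_mem_compatibleFamilies_forall_pairing_eq_fun`, liftable ↦ saturated): if the level
pairings are reduction-compatible into a value tower, the functions `g_k : X_k → Q_k` are compatible along every
SATURATED family `ξ` (`redQ (g_{k+1} ξ_{k+1}) = g_k ξ_k`) and each `g_k` is represented on the saturated level condition
`levelCondition red p C k` by some element of the finite group `Y_k`, then some compatible family `y` of `Y` has
`B_k (ξ_k, y_k) = g_k ξ_k` for every saturated `ξ` and every `k` (Kőnig on the nonempty finite sets of level
representatives, stable under `red′` by compatibility). [cite: MilneADT2006, Ch. I §0 Prop. 0.19 and Cor. 2.3]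
[cite: SerreGaloisCohomology1997, Ch. I §2.2 (compactness)] [cite: NeukirchSchmidtWingberg2008, Cor. 2.7.6] -/
theorem exists_mem_compatibleFamilies_forall_saturated_pairing_eq [∀ j, Finite (Y j)] (p : ℕ)
    (C : ∀ j, AddSubgroup (X j)) (redQ : ∀ j, Q (j + 1) →+ Q j)
    (hB : ∀ j (x : X (j + 1)) (y : Y (j + 1)), redQ j (B (j + 1) x y) = B j (red j x) (red' j y))
    (g : ∀ k, X k → Q k)
    (hg : ∀ (k : ℕ), ∀ ξ ∈ saturatedFamilies red p C, redQ k (g (k + 1) (ξ (k + 1))) = g k (ξ k))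
    (hrep : ∀ k, ∃ y : Y k, ∀ x ∈ levelCondition red p C k, B k x y = g k x) :
    ∃ y ∈ compatibleFamilies red', ∀ (k : ℕ), ∀ ξ ∈ saturatedFamilies red p C, B k (ξ k) (y k) = g k (ξ k) := by
  obtain ⟨y, hy, hyS⟩ := exists_mem_compatibleFamilies_of_forall_mem red'
    (fun k ↦ {y : Y k | ∀ ξ ∈ saturatedFamilies red p C, B k (ξ k) y = g k (ξ k)})
    (fun k ↦ by
      obtain ⟨y, hy⟩ := hrep k
      exact ⟨y, fun ξ hξ ↦ hy (ξ k) (apply_mem_levelCondition red p C hξ k)⟩)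
    (fun k y hy ξ hξ ↦ by
      have hξk : red k (ξ (k + 1)) = ξ k := ((mem_saturatedFamilies_iff red p C ξ).1 hξ).1 k
      rw [← hξk, ← hB, hy ξ hξ, hg k ξ hξ, hξk])
  exact ⟨y, hy, fun k ξ hξ ↦ hyS k ξ hξ⟩

/-- The same with the conclusion on the level conditions: `B_k (x, y_k) = g_k x` for every `x ∈ levelCondition red p C k`.
[cite: MilneADT2006, Ch. I §0 Prop. 0.19 and Cor. 2.3] -/
theorem exists_mem_compatibleFamilies_forall_levelCondition_pairing_eq [∀ j, Finite (Y j)] (p : ℕ)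
    (C : ∀ j, AddSubgroup (X j)) (redQ : ∀ j, Q (j + 1) →+ Q j)
    (hB : ∀ j (x : X (j + 1)) (y : Y (j + 1)), redQ j (B (j + 1) x y) = B j (red j x) (red' j y))
    (g : ∀ k, X k → Q k)
    (hg : ∀ (k : ℕ), ∀ ξ ∈ saturatedFamilies red p C, redQ k (g (k + 1) (ξ (k + 1))) = g k (ξ k))
    (hrep : ∀ k, ∃ y : Y k, ∀ x ∈ levelCondition red p C k, B k x y = g k x) :
    ∃ y ∈ compatibleFamilies red', ∀ (k : ℕ), ∀ x ∈ levelCondition red p C k, B k x (y k) = g k x := by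
  obtain ⟨y, hy, hyS⟩ := exists_mem_compatibleFamilies_forall_saturated_pairing_eq red red' B p C redQ hB g hg hrep
  refine ⟨y, hy, fun k x hx ↦ ?_⟩
  obtain ⟨ξ, hξ, rfl⟩ := (mem_levelCondition_iff red p C k x).1 hx
  exact hyS k ξ hξ

/-! ## §4 Assembly: levelwise perfect readings + Frobenius forms represent every compatible, additive, homogeneous
functional on the saturated families -/

/-- **Representability on the saturated families (generic (e) of the rank-free (Exact)).** Towers `X, Y, Q` with
reduction-compatible pairings `B_k`, a saturated structure `(p, C)` on `X`, and at every level: `X_k` finite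
`n_k`-torsion, `Y_k` finite, a reading `λ_k : Q_k → ℤ/n_k` whose pairing adjoint is onto `Hom(X_k, ℤ/n_k)` and which is
Frobenius for scalars `A_k` acting on `X_k`, `Q_k` (with `B_k` `A_k`-linear in `x` and the level condition `A_k`-stable).
Then every family of functions `g_k : X_k → Q_k`, additive and `A_k`-homogeneous on `levelCondition red p C k` and compatible
along the saturated families, is represented by ONE compatible family `y` of `Y`:
`B_k (ξ_k, y_k) = g_k ξ_k` for all saturated `ξ` and all `k`. [cite: MilneADT2006, Ch. I §0 Prop. 0.19 and Cor. 2.3]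
[cite: Howard2004HeegnerKolyvagin, H.4 (arXiv p. 7 L78–82: exact orthogonal complements under the local pairing)] -/
theorem exists_mem_compatibleFamilies_forall_saturated_pairing_eq_of_readings
    [∀ j, Finite (X j)] [∀ j, Finite (Y j)] (p : ℕ) (C : ∀ j, AddSubgroup (X j))
    (redQ : ∀ j, Q (j + 1) →+ Q j)
    (hB : ∀ j (x : X (j + 1)) (y : Y (j + 1)), redQ j (B (j + 1) x y) = B j (red j x) (red' j y))
    (n : ℕ → ℕ) [∀ k, NeZero (n k)] (hX : ∀ (k : ℕ) (x : X k), n k • x = 0)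
    (lam : ∀ k, Q k →+ ZMod (n k))
    (hsurj : ∀ (k : ℕ) (χ : X k →+ ZMod (n k)), ∃ y : Y k, ∀ x : X k, lam k (B k x y) = χ x)
    {A : ℕ → Type*} [∀ k, SMul (A k) (X k)] [∀ k, SMul (A k) (Q k)]
    (hfrob : ∀ (k : ℕ) (q q' : Q k), (∀ r : A k, lam k (r • q) = lam k (r • q')) → q = q')
    (hBlin : ∀ (k : ℕ) (r : A k) (x : X k) (y : Y k), B k (r • x) y = r • B k x y)
    (hL : ∀ (k : ℕ) (r : A k) (x : X k), x ∈ levelCondition red p C k → r • x ∈ levelCondition red p C k)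
    (g : ∀ k, X k → Q k)
    (hgadd : ∀ (k : ℕ), ∀ x ∈ levelCondition red p C k, ∀ x' ∈ levelCondition red p C k, g k (x + x') = g k x + g k x')
    (hgsmul : ∀ (k : ℕ) (r : A k) (x : X k), x ∈ levelCondition red p C k → g k (r • x) = r • g k x)
    (hg : ∀ (k : ℕ), ∀ ξ ∈ saturatedFamilies red p C, redQ k (g (k + 1) (ξ (k + 1))) = g k (ξ k)) :
    ∃ y ∈ compatibleFamilies red', ∀ (k : ℕ), ∀ ξ ∈ saturatedFamilies red p C, B k (ξ k) (y k) = g k (ξ k) :=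
  exists_mem_compatibleFamilies_forall_saturated_pairing_eq red red' B p C redQ hB g hg fun k ↦
    exists_forall_mem_pairing_eq_of_frobenius (B k) (lam k) (hX k) (hsurj k) (hfrob k) (hBlin k)
      (levelCondition red p C k) (hL k) (g k) (hgadd k) (hgsmul k)


/-- **Functional form.** The same with the level functionals replaced by ONE function `Ψ` on families, valued in
families of values, which on the saturated families is: well defined levelwise (`Ψ ξ k` depends only on `ξ k` —
where `ker(eval_k) ∩ Sat = p^k • Sat` enters in the application), additive, levelwise `A_k`-homogeneous, and valued in
compatible families.  Then some compatible `y` of `Y` has `B_k (ξ_k, y_k) = (Ψ ξ)_k` for every saturated `ξ` and every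
`k` — «every balanced additive functional on the saturated families into `lim Q_j` is represented by `lim Y_j`».
[cite: MilneADT2006, Ch. I §0 Prop. 0.19 and Cor. 2.3] [cite: Howard2004HeegnerKolyvagin, H.4 (arXiv p. 7 L78–82)] -/
theorem exists_mem_compatibleFamilies_forall_saturated_pairing_eq_functional
    [∀ j, Finite (X j)] [∀ j, Finite (Y j)] (p : ℕ) (C : ∀ j, AddSubgroup (X j))
    (redQ : ∀ j, Q (j + 1) →+ Q j)
    (hB : ∀ j (x : X (j + 1)) (y : Y (j + 1)), redQ j (B (j + 1) x y) = B j (red j x) (red' j y))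
    (n : ℕ → ℕ) [∀ k, NeZero (n k)] (hX : ∀ (k : ℕ) (x : X k), n k • x = 0)
    (lam : ∀ k, Q k →+ ZMod (n k))
    (hsurj : ∀ (k : ℕ) (χ : X k →+ ZMod (n k)), ∃ y : Y k, ∀ x : X k, lam k (B k x y) = χ x)
    {A : ℕ → Type*} [∀ k, SMul (A k) (X k)] [∀ k, SMul (A k) (Q k)]
    (hfrob : ∀ (k : ℕ) (q q' : Q k), (∀ r : A k, lam k (r • q) = lam k (r • q')) → q = q')
    (hBlin : ∀ (k : ℕ) (r : A k) (x : X k) (y : Y k), B k (r • x) y = r • B k x y)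
    (hL : ∀ (k : ℕ) (r : A k) (x : X k), x ∈ levelCondition red p C k → r • x ∈ levelCondition red p C k)
    (Ψ : (Π j, X j) → (Π j, Q j))
    (hwd : ∀ ξ ∈ saturatedFamilies red p C, ∀ ξ' ∈ saturatedFamilies red p C, ∀ k, ξ k = ξ' k → Ψ ξ k = Ψ ξ' k)
    (hadd : ∀ ξ ∈ saturatedFamilies red p C, ∀ ξ' ∈ saturatedFamilies red p C, Ψ (ξ + ξ') = Ψ ξ + Ψ ξ')
    (hsmul : ∀ (k : ℕ) (r : A k), ∀ ξ ∈ saturatedFamilies red p C, ∀ ξ' ∈ saturatedFamilies red p C,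
      ξ' k = r • ξ k → Ψ ξ' k = r • Ψ ξ k)
    (hcompat : ∀ ξ ∈ saturatedFamilies red p C, Ψ ξ ∈ compatibleFamilies redQ) :
    ∃ y ∈ compatibleFamilies red', ∀ ξ ∈ saturatedFamilies red p C, ∀ (k : ℕ), B k (ξ k) (y k) = Ψ ξ k := by
  classical
  -- level functions: the value of `Ψ` on any saturated family through `x`
  have hwit : ∀ (k : ℕ) (x : X k), x ∈ levelCondition red p C k → ∃ ξ ∈ saturatedFamilies red p C, ξ k = x :=
    fun k x hx ↦ (mem_levelCondition_iff red p C k x).1 hx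
  let g : ∀ k, X k → Q k := fun k x ↦
    if hx : x ∈ levelCondition red p C k then Ψ (Classical.choose (hwit k x hx)) k else 0
  have hgval : ∀ (k : ℕ), ∀ ξ ∈ saturatedFamilies red p C, g k (ξ k) = Ψ ξ k := by
    intro k ξ hξ
    have hx : ξ k ∈ levelCondition red p C k := apply_mem_levelCondition red p C hξ k
    simp only [g, dif_pos hx]
    obtain ⟨hξ', hξ'k⟩ := Classical.choose_spec (hwit k (ξ k) hx)
    exact hwd _ hξ' ξ hξ k hξ'k
  have hgadd : ∀ (k : ℕ), ∀ x ∈ levelCondition red p C k, ∀ x' ∈ levelCondition red p C k,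
      g k (x + x') = g k x + g k x' := by
    intro k x hx x' hx'
    obtain ⟨ξ, hξ, rfl⟩ := hwit k x hx
    obtain ⟨ξ', hξ', rfl⟩ := hwit k x' hx'
    rw [← Pi.add_apply ξ ξ', hgval k _ (add_mem hξ hξ'), hgval k ξ hξ, hgval k ξ' hξ', hadd ξ hξ ξ' hξ',
      Pi.add_apply]
  have hgsmul : ∀ (k : ℕ) (r : A k) (x : X k), x ∈ levelCondition red p C k → g k (r • x) = r • g k x := by
    intro k r x hx
    obtain ⟨ξ, hξ, rfl⟩ := hwit k x hx
    obtain ⟨ξ', hξ', hξ'k⟩ := hwit k (r • ξ k) (hL k r _ hx)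
    rw [← hξ'k, hgval k ξ' hξ', hgval k ξ hξ]
    exact hsmul k r ξ hξ ξ' hξ' hξ'k
  have hg : ∀ (k : ℕ), ∀ ξ ∈ saturatedFamilies red p C, redQ k (g (k + 1) (ξ (k + 1))) = g k (ξ k) := by
    intro k ξ hξ
    rw [hgval (k + 1) ξ hξ, hgval k ξ hξ]
    exact (mem_compatibleFamilies_iff redQ _).1 (hcompat ξ hξ) k
  obtain ⟨y, hy, hyS⟩ := exists_mem_compatibleFamilies_forall_saturated_pairing_eq_of_readings red red' B p C
    redQ hB n hX lam hsurj hfrob hBlin hL g hgadd hgsmul hg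
  exact ⟨y, hy, fun ξ hξ k ↦ (hyS k ξ hξ).trans (hgval k ξ hξ)⟩

end Saturated

end Tower

end Literature.NumberTheory.EllipticCurves

end
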